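import Mathlib
import Literature.MathematicalPhysics.QuantumLattice.WilsonDiracAP

/-!
# G2 assembly, auxiliary lemmas: the all-`M` bookkeeping and two small helpers
(helper for crux stmt-QuantumFields-9307 `FlatCellOptimal`, line `registered`, stub
`stub_hessianMarginAllN`; registered sub-goal `stub_hessianMarginAssemblyAuxAllN`; assembly wave 10)

What.  The `N`-free pieces of the assembly of the one-loop Hessian margin for every colour number `N`
and every half-side `M ≥ 2` (`…StubHessianMarginAllN`):
* `coe_zeta_mul_omega` — the block phases `ζ_k(μ)·ω = e^{iθ}·1 ∈ U(N)`, `θ = π k_μ/M + π/(2M)`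
  (the sibling's `CellGainCore.coe_zeta_mul_omega` with `Fin 3 ↦ Fin N`);
* `blochAngle_of_eq_four` — at `M = 4` the Bloch angles are `π/8, 3π/8, 5π/8, 7π/8`, the input shape of
  the `M = 4` block margin `BlockMargins.blockMarginM4AllN`;
* `bookkeepingG` — the real bookkeeping of the composition with ONE counting hypothesis
  `M⁴/20000 ≤ Σ_k g_k` (supplied by `stub_twistCountingAllM` for `M ≠ 4` and by the `M = 4` certificate)
  and mass slack `|m| (9 max C 0 + 5) ≤ 1/80000`, concluding `(3/80000) M⁴ 𝒦 ≤ Σ_k Q_k` — the sibling's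
  `HessianMarginOf.bookkeepingW` (`…HessianMarginOfStubsAux2`) without the region thresholds, hence
  without `M₀`.

How.  Elementary: `exp` addition, case split on `k < 4`, and linear real bookkeeping (per block
`Q_{k,m} ≥ g_k 𝒦 − |m| β_k ‖Y′‖²`, `β_k ≤ 36 (t_m + t_0) + 40`, `Σ t ≤ C M⁴`, `8‖Y′‖² ≤ 𝒦`).

Sources: folklore real arithmetic; Montvay–Münster, *Quantum Fields on a Lattice* §4.2 for the context.
Pure theorem file (no `def`s); pattern: sibling `…HessianMarginOfStubsAux2`.
-/

noncomputable section

open scoped BigOperators Classical Matrix ComplexConjugate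
open Finset
open Literature.MathematicalPhysics.QuantumLattice Literature.MathematicalPhysics.QuantumFieldTheory

namespace Summit.QuantumFields.QCD.Cruxes.FlatCellOptimal.HessianMargin

namespace HessianMarginAllN

/-! ### Two small helpers -/

/-- `ζ_k(μ) · ω` is the scalar phase `e^{iθ}·1` with `θ = π k_μ/M + π/(2M)` (every `N`). -/
theorem coe_zeta_mul_omega {N M k : ℕ} {ω z : Matrix.unitaryGroup (Fin N) ℂ}
    (hω : (ω : Matrix (Fin N) (Fin N) ℂ) =
      Complex.exp (↑(Real.pi / (2 * M : ℕ)) * Complex.I) • (1 : Matrix (Fin N) (Fin N) ℂ))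
    (hz : (z : Matrix (Fin N) (Fin N) ℂ) =
      Complex.exp (Real.pi * Complex.I * (k : ℂ) / (M : ℂ)) • (1 : Matrix (Fin N) (Fin N) ℂ)) :
    ((z * ω : Matrix.unitaryGroup (Fin N) ℂ) : Matrix (Fin N) (Fin N) ℂ) =
      Complex.exp (↑(Real.pi * (k : ℝ) / M + Real.pi / (2 * M)) * Complex.I) •
        (1 : Matrix (Fin N) (Fin N) ℂ) := by
  -- adapted from the sibling's `CellGainCore.coe_zeta_mul_omega` (`Fin 3 ↦ Fin N`)
  rw [Matrix.UnitaryGroup.mul_val]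
  change (z : Matrix (Fin N) (Fin N) ℂ) * ω = _
  rw [hω, hz, smul_mul_assoc, one_mul, smul_smul, ← Complex.exp_add]
  congr 2
  push_cast
  ring

/-- At `M = 4` the Bloch angles `π k/4 + π/8`, `k < 4`, are `π/8, 3π/8, 5π/8, 7π/8`. -/
theorem blochAngle_of_eq_four {M : ℕ} (hM : M = 4) {k : ℕ} (hk : k < M) :
    Real.pi * (k : ℝ) / M + Real.pi / (2 * M) = Real.pi / 8 ∨
      Real.pi * (k : ℝ) / M + Real.pi / (2 * M) = 3 * Real.pi / 8 ∨
        Real.pi * (k : ℝ) / M + Real.pi / (2 * M) = 5 * Real.pi / 8 ∨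
          Real.pi * (k : ℝ) / M + Real.pi / (2 * M) = 7 * Real.pi / 8 := by
  subst hM
  interval_cases k
  · exact Or.inl (by push_cast; ring)
  · exact Or.inr (Or.inl (by push_cast; ring))
  · exact Or.inr (Or.inr (Or.inl (by push_cast; ring)))
  · exact Or.inr (Or.inr (Or.inr (by push_cast; ring)))

/-! ### The real bookkeeping -/

/-- **The real bookkeeping of the all-`M` composition.**  Per block `k`: the Hessian at mass `m` is
within `|m| β_k ‖Y′‖²` of the Hessian at mass `0`, which is `≥ g_k 𝒦`; `β_k ≤ 36 (t_m(k) + t_0(k)) + 40`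
with `Σ t ≤ C M⁴`; `8‖Y′‖² ≤ 𝒦`; ONE counting hypothesis `M⁴/20000 ≤ Σ_k g_k`; the mass slack
`|m| (9 max C 0 + 5) ≤ 1/80000` then leaves `(3/80000) M⁴ 𝒦 ≤ Σ_k Q_k`. -/
theorem bookkeepingG {K : Type*} [Fintype K] {Qm Q0 g β tm t0 : K → ℝ} {m nY 𝒦 C M4 : ℝ}
    (hmass : ∀ k, |Qm k - Q0 k| ≤ |m| * β k * nY) (hP : ∀ k, g k * 𝒦 ≤ Q0 k)
    (hβ : ∀ k, β k ≤ 36 * (tm k + t0 k) + 40) (htm : ∑ k, tm k ≤ C * M4)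
    (ht0 : ∑ k, t0 k ≤ C * M4) (hcard : ∑ _k : K, (1 : ℝ) = M4) (hnY : 8 * nY ≤ 𝒦)
    (hnY0 : 0 ≤ nY) (hG : 1 / 20000 * M4 ≤ ∑ k, g k)
    (hm : |m| * (9 * max C 0 + 5) ≤ 1 / 80000) (hM4 : 0 ≤ M4) :
    3 / 80000 * M4 * 𝒦 ≤ ∑ k, Qm k := by
  -- adapted from the sibling's `HessianMarginOf.bookkeepingW` (one counting hypothesis `hG`)
  have h𝒦 : 0 ≤ 𝒦 := by linarith
  have hm0 : 0 ≤ |m| := abs_nonneg m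
  -- per block
  have h1 : ∀ k, g k * 𝒦 - |m| * nY * (36 * (tm k + t0 k) + 40) ≤ Qm k := fun k => by
    have hβ' : |m| * β k * nY ≤ |m| * (36 * (tm k + t0 k) + 40) * nY :=
      mul_le_mul_of_nonneg_right (mul_le_mul_of_nonneg_left (hβ k) hm0) hnY0
    have := (abs_le.1 ((hmass k).trans hβ')).1
    have := hP k
    linarith
  have h2 : ∑ k, (g k * 𝒦 - |m| * nY * (36 * (tm k + t0 k) + 40)) ≤ ∑ k, Qm k :=
    Finset.sum_le_sum fun k _ => h1 k
  have h3 : ∑ k, (g k * 𝒦 - |m| * nY * (36 * (tm k + t0 k) + 40)) =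
      (∑ k, g k) * 𝒦 - |m| * nY * (36 * (∑ k, tm k + ∑ k, t0 k) + 40 * M4) := by
    rw [← hcard, Finset.sum_sub_distrib, Finset.sum_mul]
    congr 1
    rw [← Finset.sum_add_distrib, Finset.mul_sum _ _ (36 : ℝ), Finset.mul_sum _ _ (40 : ℝ),
      ← Finset.sum_add_distrib, Finset.mul_sum, mul_one]
  rw [h3] at h2
  -- the lattice sums
  have hC : C ≤ max C 0 := le_max_left _ _
  have hC0 : 0 ≤ max C 0 := le_max_right _ _
  have h4 : 36 * (∑ k, tm k + ∑ k, t0 k) + 40 * M4 ≤ (72 * max C 0 + 40) * M4 := by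
    nlinarith [mul_le_mul_of_nonneg_right hC hM4]
  have h5 : |m| * nY * (36 * (∑ k, tm k + ∑ k, t0 k) + 40 * M4) ≤
      |m| * nY * ((72 * max C 0 + 40) * M4) :=
    mul_le_mul_of_nonneg_left h4 (mul_nonneg hm0 hnY0)
  have h6 : |m| * nY * ((72 * max C 0 + 40) * M4) = 8 * (|m| * (9 * max C 0 + 5)) * (nY * M4) := by
    ring
  have h7 : 8 * (|m| * (9 * max C 0 + 5)) * (nY * M4) ≤ 8 * (1 / 80000) * (nY * M4) :=
    mul_le_mul_of_nonneg_right (mul_le_mul_of_nonneg_left hm (by norm_num))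
      (mul_nonneg hnY0 hM4)
  have h8 : 8 * (1 / 80000) * (nY * M4) ≤ 1 / 80000 * (𝒦 * M4) := by nlinarith
  -- the single counting hypothesis
  have h9 : 1 / 20000 * M4 * 𝒦 ≤ (∑ k, g k) * 𝒦 := mul_le_mul_of_nonneg_right hG h𝒦
  nlinarith [mul_nonneg hM4 h𝒦]

end HessianMarginAllN

/-- **Registered sub-goal of this auxiliary file** (`stub_hessianMarginAssemblyAuxAllN`, the real
bookkeeping `HessianMarginAllN.bookkeepingG` of the all-`M` assembly): per block `k` the Hessian at mass
`m` is within `|m| β_k ‖Y′‖²` of the Hessian at mass `0`, which is `≥ g_k 𝒦`; `β_k ≤ 36 (t_m(k) + t_0(k)) + 40`,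
`Σ t ≤ C M⁴`, `8‖Y′‖² ≤ 𝒦`, the single counting hypothesis `M⁴/20000 ≤ Σ_k g_k` and the mass slack
`|m| (9 max C 0 + 5) ≤ 1/80000` give `(3/80000) M⁴ 𝒦 ≤ Σ_k Q_k`. -/
theorem stub_hessianMarginAssemblyAuxAllN : ∀ (M : ℕ) (Qm Q0 g β tm t0 : (Fin 4 → Fin M) → ℝ) (m nY 𝒦 C M4 : ℝ), (∀ k, |Qm k - Q0 k| ≤ |m| * β k * nY) → (∀ k, g k * 𝒦 ≤ Q0 k) → (∀ k, β k ≤ 36 * (tm k + t0 k) + 40) → ∑ k, tm k ≤ C * M4 → ∑ k, t0 k ≤ C * M4 → ∑ _k : Fin 4 → Fin M, (1 : ℝ) = M4 → 8 * nY ≤ 𝒦 → 0 ≤ nY → 1 / 20000 * M4 ≤ ∑ k, g k → |m| * (9 * max C 0 + 5) ≤ 1 / 80000 → 0 ≤ M4 → 3 / 80000 * M4 * 𝒦 ≤ ∑ k, Qm k :=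
  fun _ _ _ _ _ _ _ _ _ _ _ _ => HessianMarginAllN.bookkeepingG

end Summit.QuantumFields.QCD.Cruxes.FlatCellOptimal.HessianMargin

end
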